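import Mathlib
import Literature.Analysis.FluidPDE.SelfSimilar
import Literature.Analysis.FluidPDE.FlatSwirlGauge
import Literature.Analysis.FluidPDE.TsaiLocalEnergyScaling
import Literature.Analysis.FluidPDE.ChaeWolfLocalLerayProofs
import Literature.Analysis.FluidPDE.VectorCalculus
import HarnessLib

/-!
# The quarter-enstrophy slice law and the energy ½-Hölder window law on the DSS stratum

BC5 / T3 rung for the cruxes `Theses.HalfHolderEnergy.EnergyHalfHolder`
(stmt-NavierStokesRegularity-25161, route №44) and `Theses.StretchingWellBinding.EnstrophyQuarterLaw`
(stmt-NavierStokesRegularity-1574, the eI shelf; routes QuarterBudgetTrace, LerayQuarterDissipation, …).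

**Model.** A backward discretely self-similar (`λ`-DSS, `1 < λ`) velocity field
`u : ℝ → EuclideanSpace ℝ (Fin 3) → EuclideanSpace ℝ (Fin 3)`, `λ u(λ² t, λ x) = u(t, x)` (`IsDiscretelySelfSimilar λ u`), singular (if at all)
at the space–time origin. This is the standard model class for a putative Type-I blow-up
(Leray 1934 §20; Tsai 1998; Chae–Wolf 2017; Bradshaw–Tsai 2019); blow-up in this class is NOT
excluded in general (only for `λ` close to `1`, Chae–Wolf 2017, Thm 1.3 — the tree's
`Literature.Barriers.NavierStokesRegularity.NearOneDssTypeIExclusion`), so the stratum lies outside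
the regime where `NavierStokesRegularity` is known.

**Results (sorry-free).**
* `enstrophy_dss_zpow` — exact scaling of the slice enstrophy under the DSS group:
  `Z(t) = λᵏ · Z(λ²ᵏ t)` for every `k : ℤ`, `Z(t) = ∫ ‖curl u(t)‖²`.
* `enstrophySlice_of_dss` — the analogue of `EnstrophyQuarterLaw` on the stratum: a bound
  `Z ≤ B` on ONE period `t ∈ [−λ², −1]` forces the quarter law `Z(t) ≤ λ B / √(−t)` for all `t < 0`
  (the slice law is exactly the DSS-invariant normalisation of enstrophy — the route's lever).
* `energyHalfHolder_rung_dss` — the analogue of `EnergyHalfHolder`: the window law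
  `∫_a^b Z ≤ 2 λ B √(b − a)` for all `a ≤ b ≤ 0`.

No statement about `NavierStokesRegularity` is proved here; this is a witness of weakness
(the cruxes' analogues are decided on a stratum where the summit's analogue is open).
-/

open scoped ENNReal NNReal Topology
open MeasureTheory Set Filter

namespace Summit.NavierStokesRegularity.NavierStokesRegularity.Theorems

namespace HalfHolderEnergyDssRung

open Literature.Analysis.FluidPDE

/-- **Enstrophy scaling on the DSS group.** If `u` is `c`-DSS then for every `k : ℤ` and every
time `t`, `∫ ‖curl u(t)‖² = c^k ∫ ‖curl u((c^k)² t)‖²`. -/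
theorem enstrophy_dss_zpow {c : ℝ} (hc : 0 < c) {u : ℝ → EuclideanSpace ℝ (Fin 3) → EuclideanSpace ℝ (Fin 3)}
    (h : IsDiscretelySelfSimilar c u) (k : ℤ) (t : ℝ) :
    ∫⁻ x, ‖curl (u t) x‖ₑ ^ 2
      = ENNReal.ofReal (c ^ k) * ∫⁻ x, ‖curl (u ((c ^ k) ^ 2 * t)) x‖ₑ ^ 2 := by
  have hk : nsRescale (c ^ k) u = u := ChaeWolf2018.nsRescale_zpow_eq hc.ne' h k
  set L : ℝ := c ^ k with hL
  have hL0 : 0 < L := zpow_pos hc k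
  have hu : u t = fun y => L • u (L ^ 2 * t) (L • y) := by
    funext y
    have := congrFun (congrFun hk t) y
    simpa [nsRescale] using this.symm
  have hcurl : ∀ x, curl (u t) x = (L * L) • curl (u (L ^ 2 * t)) (L • x) := by
    intro x
    rw [hu]
    exact curl_smul_comp_smul _ L L x
  have hLL : ‖L * L‖ₑ = ENNReal.ofReal (L * L) := Real.enorm_eq_ofReal (by positivity)
  calc ∫⁻ x, ‖curl (u t) x‖ₑ ^ 2
      = ∫⁻ x, (fun y => ‖(L * L) • curl (u (L ^ 2 * t)) y‖ₑ ^ 2) (L • x) := by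
          simp_rw [hcurl]
    _ = ENNReal.ofReal ((L ^ 3)⁻¹) * ∫⁻ y, ‖(L * L) • curl (u (L ^ 2 * t)) y‖ₑ ^ 2 :=
          lintegral_comp_smul_fin3 (fun y => ‖(L * L) • curl (u (L ^ 2 * t)) y‖ₑ ^ 2) hL0
    _ = ENNReal.ofReal ((L ^ 3)⁻¹) *
          (ENNReal.ofReal (L * L) ^ 2 * ∫⁻ y, ‖curl (u (L ^ 2 * t)) y‖ₑ ^ 2) := by
          congr 1
          rw [← lintegral_const_mul' _ _ (by simp)]
          congr 1
          funext y
          rw [enorm_smul, mul_pow, hLL]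
    _ = ENNReal.ofReal L * ∫⁻ y, ‖curl (u (L ^ 2 * t)) y‖ₑ ^ 2 := by
          rw [← mul_assoc]
          congr 1
          rw [← ENNReal.ofReal_pow (by positivity), ← ENNReal.ofReal_mul (by positivity)]
          congr 1
          rw [inv_mul_eq_iff_eq_mul₀ (by positivity)]
          ring

/-- **The quarter-enstrophy slice law on the DSS stratum** (analogue of
`Theses.StretchingWellBinding.EnstrophyQuarterLaw`): a one-period enstrophy bound propagates, by
the DSS group alone, to `Z(t) ≤ c B / √(−t)` for all `t < 0`. -/
theorem enstrophySlice_of_dss {c : ℝ} (hc : 1 < c) {u : ℝ → EuclideanSpace ℝ (Fin 3) → EuclideanSpace ℝ (Fin 3)}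
    (h : IsDiscretelySelfSimilar c u) {B : ℝ}
    (hB : ∀ s ∈ Set.Icc (-(c ^ 2)) (-1), ∫⁻ x, ‖curl (u s) x‖ₑ ^ 2 ≤ ENNReal.ofReal B) :
    ∀ t < 0, ∫⁻ x, ‖curl (u t) x‖ₑ ^ 2 ≤ ENNReal.ofReal (c * B / Real.sqrt (-t)) := by
  intro t ht
  have hc0 : 0 < c := lt_trans one_pos hc
  have hnt : 0 < -t := neg_pos.2 ht
  set r : ℝ := Real.sqrt (-t) with hr
  have hr0 : 0 < r := Real.sqrt_pos.2 hnt
  have hrr : r * r = -t := Real.mul_self_sqrt hnt.le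
  obtain ⟨n, hn1, hn2⟩ := exists_mem_Ico_zpow (inv_pos.2 hr0) hc
  -- `c ^ n ≤ r⁻¹ < c ^ (n + 1)`; zoom factor `L = c ^ (n + 1)`
  have hL0 : 0 < c ^ (n + 1) := zpow_pos hc0 _
  have hLle : c ^ (n + 1) ≤ c * r⁻¹ := by
    rw [zpow_add_one₀ hc0.ne', mul_comm]
    exact mul_le_mul_of_nonneg_left hn1 hc0.le
  have hLr_le : c ^ (n + 1) * r ≤ c := by
    have := mul_le_mul_of_nonneg_right hLle hr0.le
    rwa [mul_assoc, inv_mul_cancel₀ hr0.ne', mul_one] at this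
  have hLr_gt : 1 < c ^ (n + 1) * r := by
    have := mul_lt_mul_of_pos_right hn2 hr0
    rwa [inv_mul_cancel₀ hr0.ne'] at this
  have hs : (c ^ (n + 1)) ^ 2 * t ∈ Set.Icc (-(c ^ 2)) (-1) := by
    constructor
    · have h2 : (c ^ (n + 1)) ^ 2 * (-t) ≤ c ^ 2 := by
        rw [← hrr]
        calc (c ^ (n + 1)) ^ 2 * (r * r) = (c ^ (n + 1) * r) ^ 2 := by ring
          _ ≤ c ^ 2 := pow_le_pow_left₀ (by positivity) hLr_le 2
      linarith
    · have h2 : 1 ≤ (c ^ (n + 1)) ^ 2 * (-t) := by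
        rw [← hrr]
        have : (1 : ℝ) ≤ (c ^ (n + 1) * r) ^ 2 := by nlinarith
        calc (1 : ℝ) ≤ (c ^ (n + 1) * r) ^ 2 := this
          _ = (c ^ (n + 1)) ^ 2 * (r * r) := by ring
      linarith
  rw [enstrophy_dss_zpow hc0 h (n + 1) t]
  rcases le_or_gt 0 B with hB0 | hB0
  · calc ENNReal.ofReal (c ^ (n + 1)) * ∫⁻ x, ‖curl (u ((c ^ (n + 1)) ^ 2 * t)) x‖ₑ ^ 2
        ≤ ENNReal.ofReal (c ^ (n + 1)) * ENNReal.ofReal B := by gcongr; exact hB _ hs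
      _ = ENNReal.ofReal (c ^ (n + 1) * B) := (ENNReal.ofReal_mul hL0.le).symm
      _ ≤ ENNReal.ofReal (c * B / Real.sqrt (-t)) := by
          apply ENNReal.ofReal_le_ofReal
          have : c * B / Real.sqrt (-t) = c * r⁻¹ * B := by rw [hr]; ring
          rw [this]
          exact mul_le_mul_of_nonneg_right hLle hB0
  · calc ENNReal.ofReal (c ^ (n + 1)) * ∫⁻ x, ‖curl (u ((c ^ (n + 1)) ^ 2 * t)) x‖ₑ ^ 2
        ≤ ENNReal.ofReal (c ^ (n + 1)) * ENNReal.ofReal B := by gcongr; exact hB _ hs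
      _ = 0 := by rw [ENNReal.ofReal_of_nonpos hB0.le, mul_zero]
      _ ≤ _ := by simp

/-- **The energy ½-Hölder window law on the DSS stratum** (analogue of
`Theses.HalfHolderEnergy.EnergyHalfHolder`, item stmt-NavierStokesRegularity-25161): under a
one-period enstrophy bound, every backward window carries enstrophy `≤ 2 c B √(b − a)`. -/
theorem energyHalfHolder_rung_dss {c : ℝ} (hc : 1 < c) {u : ℝ → EuclideanSpace ℝ (Fin 3) → EuclideanSpace ℝ (Fin 3)}
    (h : IsDiscretelySelfSimilar c u) {B : ℝ} (hB0 : 0 ≤ B)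
    (hB : ∀ s ∈ Set.Icc (-(c ^ 2)) (-1), ∫⁻ x, ‖curl (u s) x‖ₑ ^ 2 ≤ ENNReal.ofReal B) :
    ∀ a b : ℝ, a ≤ b → b ≤ 0 →
      ∫⁻ t in Set.Ioo a b, ∫⁻ x, ‖curl (u t) x‖ₑ ^ 2
        ≤ ENNReal.ofReal (2 * c * B * Real.sqrt (b - a)) := by
  intro a b hab hb
  have hc0 : 0 < c := lt_trans one_pos hc
  have hslice := enstrophySlice_of_dss hc h hB
  -- the majorant `f t = c B / √(b − t)` and its primitive `G t = −(2 c B) √(b − t)`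
  have hf_nonneg : ∀ t, 0 ≤ c * B / Real.sqrt (b - t) := fun t => by positivity
  have hderiv : ∀ t ∈ Set.Ioo a b,
      HasDerivAt (fun s : ℝ => -(2 * c * B) * Real.sqrt (b - s)) (c * B / Real.sqrt (b - t)) t := by
    intro t htmem
    have hbt : 0 < b - t := by linarith [htmem.2]
    have h1 : HasDerivAt (fun s : ℝ => b - s) (-1) t := by
      simpa using (hasDerivAt_id t).const_sub b
    have h2 := (h1.sqrt hbt.ne').const_mul (-(2 * c * B))
    have hsq : Real.sqrt (b - t) ≠ 0 := (Real.sqrt_pos.2 hbt).ne'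
    have hval : -(2 * c * B) * (-1 / (2 * Real.sqrt (b - t))) = c * B / Real.sqrt (b - t) := by
      rw [mul_div_assoc', div_eq_div_iff (mul_ne_zero two_ne_zero hsq) hsq]
      ring
    exact h2.congr_deriv hval
  have hcont : ContinuousOn (fun s : ℝ => -(2 * c * B) * Real.sqrt (b - s)) (Set.uIcc a b) :=
    (Continuous.continuousOn (by fun_prop))
  have hderiv' : ∀ t ∈ Set.Ioo (min a b) (max a b),
      HasDerivAt (fun s : ℝ => -(2 * c * B) * Real.sqrt (b - s)) (c * B / Real.sqrt (b - t)) t := by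
    rw [min_eq_left hab, max_eq_right hab]; exact hderiv
  have hint : IntervalIntegrable (fun t => c * B / Real.sqrt (b - t)) volume a b :=
    intervalIntegral.intervalIntegrable_deriv_of_nonneg hcont hderiv' (fun t _ => hf_nonneg t)
  have hFTC : ∫ t in a..b, c * B / Real.sqrt (b - t) = 2 * c * B * Real.sqrt (b - a) := by
    rw [intervalIntegral.integral_eq_sub_of_hasDerivAt_of_le hab
      (hcont.mono (by rw [Set.uIcc_of_le hab])) hderiv hint]
    simp only [sub_self, Real.sqrt_zero, mul_zero]
    ring
  -- pointwise comparison on the window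
  have hpt : ∀ t ∈ Set.Ioo a b,
      ∫⁻ x, ‖curl (u t) x‖ₑ ^ 2 ≤ ENNReal.ofReal (c * B / Real.sqrt (b - t)) := by
    intro t htmem
    have ht0 : t < 0 := lt_of_lt_of_le htmem.2 hb
    have hbt : 0 < b - t := by linarith [htmem.2]
    refine (hslice t ht0).trans (ENNReal.ofReal_le_ofReal ?_)
    have hcB : 0 ≤ c * B := by positivity
    exact div_le_div_of_nonneg_left hcB (Real.sqrt_pos.2 hbt)
      (Real.sqrt_le_sqrt (by linarith))
  have hIoo : IntegrableOn (fun t => c * B / Real.sqrt (b - t)) (Set.Ioo a b) volume :=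
    ((intervalIntegrable_iff_integrableOn_Ioc_of_le hab).1 hint).mono_set Set.Ioo_subset_Ioc_self
  calc ∫⁻ t in Set.Ioo a b, ∫⁻ x, ‖curl (u t) x‖ₑ ^ 2
      ≤ ∫⁻ t in Set.Ioo a b, ENNReal.ofReal (c * B / Real.sqrt (b - t)) :=
          setLIntegral_mono' measurableSet_Ioo hpt
    _ = ENNReal.ofReal (∫ t in Set.Ioo a b, c * B / Real.sqrt (b - t)) := by
          rw [ofReal_integral_eq_lintegral_ofReal hIoo
            (Filter.Eventually.of_forall fun t => hf_nonneg t)]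
    _ = ENNReal.ofReal (2 * c * B * Real.sqrt (b - a)) := by
          rw [← hFTC, intervalIntegral.integral_of_le hab, integral_Ioc_eq_integral_Ioo]

/-- The window law in the exact `∃ K`-shape of `EnergyHalfHolder` (restricted to backward windows
`a ≤ b ≤ 0` of the DSS stratum). -/
theorem energyHalfHolder_rung_dss' {c : ℝ} (hc : 1 < c) {u : ℝ → EuclideanSpace ℝ (Fin 3) → EuclideanSpace ℝ (Fin 3)}
    (h : IsDiscretelySelfSimilar c u) {B : ℝ}
    (hB : ∀ s ∈ Set.Icc (-(c ^ 2)) (-1), ∫⁻ x, ‖curl (u s) x‖ₑ ^ 2 ≤ ENNReal.ofReal B) :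
    ∃ K : ℝ, ∀ a b : ℝ, a ≤ b → b ≤ 0 →
      ∫⁻ t in Set.Ioo a b, ∫⁻ x, ‖curl (u t) x‖ₑ ^ 2 ≤ ENNReal.ofReal (K * Real.sqrt (b - a)) := by
  refine ⟨2 * c * max B 0, fun a b hab hb => ?_⟩
  have hB' : ∀ s ∈ Set.Icc (-(c ^ 2)) (-1),
      ∫⁻ x, ‖curl (u s) x‖ₑ ^ 2 ≤ ENNReal.ofReal (max B 0) := fun s hs =>
    (hB s hs).trans (ENNReal.ofReal_le_ofReal (le_max_left _ _))
  simpa [mul_assoc] using energyHalfHolder_rung_dss hc h (le_max_right _ _) hB' a b hab hb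

end HalfHolderEnergyDssRung

end Summit.NavierStokesRegularity.NavierStokesRegularity.Theorems
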